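import Summits.BirchSwinnertonDyer.Rank1Residual.AdditivePotMult.QuadraticBaseChangeNormValuation
import Literature.NumberTheory.EllipticCurves.TamagawaSubgroupProofs
import Literature.NumberTheory.EllipticCurves.TamagawaFiniteIndexProofs
import Literature.NumberTheory.EllipticCurves.TamagawaVariableChangeProofs
import HarnessLib

/-!
# The odd Tamagawa identity of Milne's quadratic BSD quotient, assembled from local identities
# (row T-MIL-ODD, FILE C-2 — the ASSEMBLY SCHEMA; seat n1011-p01 GEN 6)

HONEST FRAMING (cell `b2b-bsdres`, run/shared/lean/b2b/bsd-rank1-residual/, verbatim in every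
file): the goal of the cell is to DELETE the COMBINATION-SHAPED residual classes of the
Birch–Swinnerton-Dyer formula for ALL analytic-rank `≤ 1` elliptic curves over `ℚ` — "full BSD
formula for every rank `≤ 1` curve in class `C`" assembled STRICTLY from published theorems — so
that the rank-`≤ 1` remainder becomes exactly the CONSTRUCTION-SHAPED classes, which are TYPED
(missing-input `Prop`s), NOT attempted. This is not "finishing BSD". Sub-classes X3♯(M) / X4(M)
(additive, potentially multiplicative prime; base-change-and-descend): a RESEARCH ROUTE; they stay
CONSTRUCTION-SHAPED; nothing is booked by this file; no mark / label moved. THEOREMS ONLY: no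
definition, no named fact, no `sorry`.

## What and why (row T-MIL-ODD, `cells/n1011/skel/T-MIL-ODD.md` §0 and §6)

Hypothesis `hodd` of the tree's `WeierstrassCurve.bsdRHS_baseChange_quadratic_of_padicValRat`
(`Literature/…/BSDQuadraticDescentTorsionOddPartProofs.lean`; the odd part of Milne 1972 §1 /
Dokchitser–Dokchitser 2010 Thm. 8, i.e. what is left of the named fact
`bsdRHS_baseChange_quadratic` — the Burungale–Flach descent input — after its `2`-adic part and the
odd `Ш`/Mordell–Weil balances proved there) asks, for every odd prime `p` and every datum
`(W, K, W_d = C_d • W^{(d_K)}, W' = C' • W_K)`: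

  `(ODD-TAM)@p   v_p(|N_{K/ℚ}(C'.u)| · ∏_w c_w(W')) = v_p(|C_d.u| · ∏_ℓ c_ℓ(W) · ∏_ℓ c_ℓ(W_d))`.

This file proves the BOOKKEEPING half once and for all: (ODD-TAM)@p FOLLOWS from local identities,
one per finite place `v` of `ℚ` —

  (T)  `v ≠ p`:  `Σ_{w ∣ v} v_p(c_w(W')) = v_p(c_v(W)) + v_p(c_v(W_d))`,
  (P)  `v = p`:  `Σ_{w ∣ p} (v_p(c_w(W')) + f(w|p)·ord_w(C'.u)) = v_p(c_p(W)) + v_p(c_p(W_d)) + ord_p(C_d.u)`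

— for ANY number field `K`, ANY prime `p` and ANY three elliptic curves `W, W_d / ℚ`, `W' / K`
and units `u' ∈ K^×`, `u_d ∈ ℚ^×` (`padicValRat_norm_mul_tamagawaProduct_eq_of_local`; the
variant `…_of_local_baseChange` takes `W' = C' • W_K` and the hypotheses on `W_K`, by the
isomorphism invariance of the `c_w`, tree `localTamagawaNumber_variableChange_holds` /
`tamagawaProduct_variableChange_eq`). The three Tamagawa products are finite products over the
places (tree `mulSupport_localTamagawaNumber_finite_holds`); the `K`-side is regrouped along the
finite fibres of `w ↦ w ∩ 𝓞 ℚ` (`Finset.sum_fiberwise_of_maps_to`) — the SAME regrouping as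
x11b/multr1-p1's `X11b/TamagawaQuadraticBaseChange.padicValNat_tamagawaProduct_baseChange_quadratic`
(Castella §5 / JSW (eq:tamK), there for `p ≥ 5` under a `p`-unit hypothesis at the non-split bad
primes and WITHOUT the unit terms); the unit terms are FILE C-1
(`padicValRat_abs_norm_eq_sum_fibre`: `v_p|N(u')| = Σ_{w∣p} f_w·ord_w(u')`,
`padicValRat_eq_neg_log_valuation`). All ARITHMETIC content — reduction types of `W` at `v`,
splitting of `v` in `K`, Tate's algorithm, the `δ`-terms — sits in (T)/(P), which the stage-A/B files
of the row discharge per case (FILE C-3 onward). In Milne's proof (T)/(P) are the `p`-parts of the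
local indices of `E × E^{(D)} → Res_{K/ℚ} E_K` (*ADT* I.7.3); nothing of that is used here.
HONEST LIMITS: TOOL theorems; closes no class; discharges no fact by itself.
-/

noncomputable section

open scoped Classical NumberField

open WeierstrassCurve NumberField IsDedekindDomain Rat.HeightOneSpectrum WithZero
  Literature.NumberTheory.EllipticCurves

namespace Summit.BirchSwinnertonDyer.Rank1Residual.AdditivePotMult

section Assembly

variable (W : WeierstrassCurve ℚ) [W.IsElliptic] (Wd : WeierstrassCurve ℚ) [Wd.IsElliptic]
  {K : Type*} [Field K] [NumberField K] (W' : WeierstrassCurve K) [W'.IsElliptic]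

/-- **THE ASSEMBLY SCHEMA of the odd Tamagawa identity.** For elliptic `W, W_d / ℚ`, `W' / K`
(`K` any number field), `u' ∈ K^×`, `u_d ∈ ℚ^×`, a prime `p` under the place `v₀`: IF
(T) at every finite place `v ≠ v₀` of `ℚ`, `Σ_{w ∣ v} v_p(c_w(W')) = v_p(c_v(W)) + v_p(c_v(W_d))`,
and (P) at `v₀`, `Σ_{w ∣ v₀} (v_p(c_w(W')) + f(w|p)·ord_w(u')) = v_p(c_{v₀}(W)) + v_p(c_{v₀}(W_d)) +
ord_p(u_d)` (`ord_w = −log ∘ w.valuation K`, fibres `{w : w ∩ 𝓞 ℚ = v}` as `Finset`s of the tree's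
`finite_setOf_under_eq_of_numberField`), THEN
`v_p(|N_{K/ℚ}(u')| · ∏_w c_w(W')) = v_p(|u_d| · ∏_v c_v(W) · ∏_v c_v(W_d))` — literally the body of
`hodd` in `bsdRHS_baseChange_quadratic_of_padicValRat` with `u' = C'.u`, `u_d = C_d.u`. Proof: the
products are finite products over the places, `v_p` turns them into sums
(`padicValNat_finprod_eq_finsum`), the `K`-sum is regrouped along the fibres of `w ↦ w ∩ 𝓞 ℚ`
(`Finset.sum_fiberwise_of_maps_to`, as in x11b's `padicValNat_tamagawaProduct_baseChange_quadratic`),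
and the unit terms are `Σ_{w∣p} f_w·ord_w(u')` / `ord_p(u_d)` by FILE C-1.
[cite: Milne1972ArithmeticAV, §1 Thm. 1 and §2 (through DokchitserDokchitserAnnals2010, §2.1, proof of Thm. 8)] -/
theorem padicValRat_norm_mul_tamagawaProduct_eq_of_local {u' : K} (hu' : u' ≠ 0) {ud : ℚ}
    (hud : ud ≠ 0) (p : ℕ) [Fact p.Prime] (v₀ : HeightOneSpectrum (𝓞 ℚ))
    (hv₀ : (primesEquiv v₀ : ℕ) = p)
    (hT : ∀ v : HeightOneSpectrum (𝓞 ℚ), v ≠ v₀ →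
      ∑ w ∈ (HeightOneSpectrum.finite_setOf_under_eq_of_numberField (K := K) v).toFinset,
          padicValNat p ((W'.baseChange (w.adicCompletion K)).localTamagawaNumber
            (w.adicCompletionIntegers K)) =
        padicValNat p ((W.baseChange (v.adicCompletion ℚ)).localTamagawaNumber
            (v.adicCompletionIntegers ℚ)) +
          padicValNat p ((Wd.baseChange (v.adicCompletion ℚ)).localTamagawaNumber
            (v.adicCompletionIntegers ℚ)))
    (hP : ∑ w ∈ (HeightOneSpectrum.finite_setOf_under_eq_of_numberField (K := K) v₀).toFinset,
          ((padicValNat p ((W'.baseChange (w.adicCompletion K)).localTamagawaNumber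
              (w.adicCompletionIntegers K)) : ℤ) +
            (w.asIdeal.inertiaDeg (𝓞 ℚ) : ℤ) * (-log (w.valuation K u'))) =
        (padicValNat p ((W.baseChange (v₀.adicCompletion ℚ)).localTamagawaNumber
            (v₀.adicCompletionIntegers ℚ)) : ℤ) +
          padicValNat p ((Wd.baseChange (v₀.adicCompletion ℚ)).localTamagawaNumber
            (v₀.adicCompletionIntegers ℚ)) +
          (-log (v₀.valuation ℚ ud))) :
    padicValRat p (|Algebra.norm ℚ u'| * W'.tamagawaProduct : ℚ) =
      padicValRat p (|ud| * (W.tamagawaProduct * Wd.tamagawaProduct) : ℚ) := by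
  have hpr : p.Prime := Fact.out
  -- the three local Tamagawa functions
  set cK : HeightOneSpectrum (𝓞 K) → ℕ := fun w =>
    (W'.baseChange (w.adicCompletion K)).localTamagawaNumber (w.adicCompletionIntegers K) with hcK
  set cQ : HeightOneSpectrum (𝓞 ℚ) → ℕ := fun v =>
    (W.baseChange (v.adicCompletion ℚ)).localTamagawaNumber (v.adicCompletionIntegers ℚ) with hcQ
  set cD : HeightOneSpectrum (𝓞 ℚ) → ℕ := fun v =>
    (Wd.baseChange (v.adicCompletion ℚ)).localTamagawaNumber (v.adicCompletionIntegers ℚ) with hcD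
  have hfinK : (Function.mulSupport cK).Finite := W'.mulSupport_localTamagawaNumber_finite_holds
  have hfinQ : (Function.mulSupport cQ).Finite := W.mulSupport_localTamagawaNumber_finite_holds
  have hfinD : (Function.mulSupport cD).Finite := Wd.mulSupport_localTamagawaNumber_finite_holds
  -- fibres of `K → ℚ` on places and the finite index sets
  set F : HeightOneSpectrum (𝓞 ℚ) → Finset (HeightOneSpectrum (𝓞 K)) := fun v =>
    (HeightOneSpectrum.finite_setOf_under_eq_of_numberField (K := K) v).toFinset with hF
  have hmemF : ∀ v w, w ∈ F v ↔ w.under (𝓞 ℚ) = v := fun v w => by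
    simp [hF, Set.Finite.mem_toFinset]
  set SQ : Finset (HeightOneSpectrum (𝓞 ℚ)) :=
    hfinK.toFinset.image (fun w => w.under (𝓞 ℚ)) ∪ hfinQ.toFinset ∪ hfinD.toFinset ∪ {v₀} with hSQ
  set SK : Finset (HeightOneSpectrum (𝓞 K)) := SQ.biUnion F with hSK
  have hv₀SQ : v₀ ∈ SQ := by
    rw [hSQ, Finset.mem_union]; exact Or.inr (Finset.mem_singleton_self _)
  have hsubK : Function.mulSupport cK ⊆ ↑SK := by
    intro w hw
    rw [Finset.mem_coe, hSK, Finset.mem_biUnion]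
    refine ⟨w.under (𝓞 ℚ), ?_, (hmemF _ _).mpr rfl⟩
    rw [hSQ, Finset.mem_union, Finset.mem_union, Finset.mem_union, Finset.mem_image]
    exact Or.inl (Or.inl (Or.inl ⟨w, hfinK.mem_toFinset.mpr hw, rfl⟩))
  have hsubQ : Function.mulSupport cQ ⊆ ↑SQ := fun v hv => by
    rw [Finset.mem_coe, hSQ, Finset.mem_union, Finset.mem_union, Finset.mem_union]
    exact Or.inl (Or.inl (Or.inr (hfinQ.mem_toFinset.mpr hv)))
  have hsubD : Function.mulSupport cD ⊆ ↑SQ := fun v hv => by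
    rw [Finset.mem_coe, hSQ, Finset.mem_union, Finset.mem_union, Finset.mem_union]
    exact Or.inl (Or.inr (hfinD.mem_toFinset.mpr hv))
  -- `ord_p` of the three products as sums over the index sets
  have hK' : (padicValNat p W'.tamagawaProduct : ℤ) = ∑ w ∈ SK, (padicValNat p (cK w) : ℤ) := by
    rw [show W'.tamagawaProduct = ∏ᶠ w, cK w from rfl,
      finprod_eq_prod_of_mulSupport_subset cK hsubK, ← Nat.cast_sum, Nat.cast_inj]
    rw [← finprod_eq_prod_of_mulSupport_subset cK hsubK,
      padicValNat_finprod_eq_finsum p hfinK fun w => W'.localTamagawaNumber_baseChange_ne_zero w]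
    refine finsum_eq_sum_of_support_subset _ fun w hw => hsubK ?_
    rw [Function.mem_support] at hw
    rw [Function.mem_mulSupport]
    intro h1; exact hw (by rw [h1, padicValNat_one_right])
  have hQ' : (padicValNat p W.tamagawaProduct : ℤ) = ∑ v ∈ SQ, (padicValNat p (cQ v) : ℤ) := by
    rw [show W.tamagawaProduct = ∏ᶠ v, cQ v from rfl, ← Nat.cast_sum, Nat.cast_inj,
      padicValNat_finprod_eq_finsum p hfinQ fun v => W.localTamagawaNumber_baseChange_ne_zero v]
    refine finsum_eq_sum_of_support_subset _ fun v hv => hsubQ ?_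
    rw [Function.mem_support] at hv
    rw [Function.mem_mulSupport]
    intro h1; exact hv (by rw [h1, padicValNat_one_right])
  have hD' : (padicValNat p Wd.tamagawaProduct : ℤ) = ∑ v ∈ SQ, (padicValNat p (cD v) : ℤ) := by
    rw [show Wd.tamagawaProduct = ∏ᶠ v, cD v from rfl, ← Nat.cast_sum, Nat.cast_inj,
      padicValNat_finprod_eq_finsum p hfinD fun v => Wd.localTamagawaNumber_baseChange_ne_zero v]
    refine finsum_eq_sum_of_support_subset _ fun v hv => hsubD ?_
    rw [Function.mem_support] at hv
    rw [Function.mem_mulSupport]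
    intro h1; exact hv (by rw [h1, padicValNat_one_right])
  -- regroup the `K`-side along the fibres
  have hmaps : ∀ w ∈ SK, w.under (𝓞 ℚ) ∈ SQ := by
    intro w hw
    rw [hSK, Finset.mem_biUnion] at hw
    obtain ⟨v, hv, hwv⟩ := hw
    rwa [(hmemF v w).mp hwv]
  have hfib : ∀ v ∈ SQ, SK.filter (fun w => w.under (𝓞 ℚ) = v) = F v := by
    intro v hv
    ext w
    simp only [Finset.mem_filter, hmemF]
    constructor
    · exact fun h => h.2
    · intro h
      refine ⟨?_, h⟩
      rw [hSK, Finset.mem_biUnion]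
      exact ⟨v, hv, (hmemF v w).mpr h⟩
  have hKfib : ∑ w ∈ SK, (padicValNat p (cK w) : ℤ) =
      ∑ v ∈ SQ, ∑ w ∈ F v, (padicValNat p (cK w) : ℤ) := by
    rw [← Finset.sum_fiberwise_of_maps_to hmaps]
    exact Finset.sum_congr rfl fun v hv => by rw [hfib v hv]
  -- the unit terms
  haveI : Fact (Nat.Prime ((primesEquiv v₀ : Nat.Primes) : ℕ)) := ⟨(primesEquiv v₀).2⟩
  have hN : padicValRat p |Algebra.norm ℚ u'| =
      ∑ w ∈ F v₀, (w.asIdeal.inertiaDeg (𝓞 ℚ) : ℤ) * (-log (w.valuation K u')) := by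
    rw [← hv₀]; exact padicValRat_abs_norm_eq_sum_fibre v₀ hu'
  have hU : padicValRat p |ud| = -log (v₀.valuation ℚ ud) := by
    rw [← hv₀, ← padicValRat_eq_neg_log_valuation v₀ hud]
    rcases abs_choice ud with h | h <;> rw [h]
    exact padicValRat.neg _
  -- nonvanishing, and the valuations of the two products
  have hnorm : Algebra.norm ℚ u' ≠ 0 := Algebra.norm_ne_zero_iff.mpr hu'
  have ha : (|Algebra.norm ℚ u'| : ℚ) ≠ 0 := abs_ne_zero.mpr hnorm
  have hb : (|ud| : ℚ) ≠ 0 := abs_ne_zero.mpr hud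
  have hT' : (W'.tamagawaProduct : ℚ) ≠ 0 := by exact_mod_cast W'.tamagawaProduct_pos'.ne'
  have hTQ : (W.tamagawaProduct : ℚ) ≠ 0 := by exact_mod_cast W.tamagawaProduct_pos'.ne'
  have hTD : (Wd.tamagawaProduct : ℚ) ≠ 0 := by exact_mod_cast Wd.tamagawaProduct_pos'.ne'
  rw [padicValRat.mul ha hT', padicValRat.mul hb (mul_ne_zero hTQ hTD), padicValRat.mul hTQ hTD,
    padicValRat.of_nat, padicValRat.of_nat, padicValRat.of_nat, hN, hU, hK', hQ', hD', hKfib]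
  -- pointwise: the local identities
  have hpt : ∀ v ∈ SQ, (∑ w ∈ F v, (padicValNat p (cK w) : ℤ)) +
      (if v = v₀ then ∑ w ∈ F v₀, (w.asIdeal.inertiaDeg (𝓞 ℚ) : ℤ) * (-log (w.valuation K u'))
        else 0) =
      (padicValNat p (cQ v) : ℤ) + padicValNat p (cD v) +
        (if v = v₀ then -log (v₀.valuation ℚ ud) else 0) := by
    intro v _
    by_cases hv : v = v₀
    · subst hv
      rw [if_pos rfl, if_pos rfl, ← hP, Finset.sum_add_distrib]
    · rw [if_neg hv, if_neg hv, add_zero, add_zero, ← Nat.cast_add, ← hT v hv, Nat.cast_sum]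
  have hsum := Finset.sum_congr rfl hpt
  rw [Finset.sum_add_distrib, Finset.sum_add_distrib, Finset.sum_add_distrib,
    Finset.sum_ite_eq' SQ v₀, Finset.sum_ite_eq' SQ v₀, if_pos hv₀SQ, if_pos hv₀SQ] at hsum
  linear_combination hsum

omit [W'.IsElliptic] in
/-- `c_w(W') = c_w(W_K)` for a `K`-model `W' = C' • W_K` (the local Tamagawa number is an isomorphism
invariant: tree `localTamagawaNumber_variableChange_holds` at the completion, Mathlib
`map_variableChange`). [cite: SilvermanAEC2009, VII.1 Prop. 1.3(b) with VII.6 (Ex. 7.6)] -/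
theorem localTamagawaNumber_eq_of_smul_baseChange {C' : VariableChange K}
    (hW' : C' • W.baseChange K = W') (w : HeightOneSpectrum (𝓞 K)) :
    (W'.baseChange (w.adicCompletion K)).localTamagawaNumber (w.adicCompletionIntegers K) =
      ((W.baseChange K).baseChange (w.adicCompletion K)).localTamagawaNumber
        (w.adicCompletionIntegers K) := by
  haveI : (W.baseChange K).IsElliptic := by rw [baseChange]; infer_instance
  haveI : ((W.baseChange K).baseChange (w.adicCompletion K)).IsElliptic := by
    rw [baseChange]; infer_instance
  rw [← hW', baseChange, ← map_variableChange]
  exact localTamagawaNumber_variableChange_holds (w.adicCompletionIntegers K)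
    ((W.baseChange K).map (algebraMap K (w.adicCompletion K))) (C'.map (algebraMap K _))

omit [W'.IsElliptic] in
/-- **The schema for a `K`-model `W' = C' • W_K`**, hypotheses (T)/(P) read on `W_K ⊗ K_w` (the
currency of the row's stage-A files `QuadraticBaseChange*`): `∏_w c_w(W') = ∏_w c_w(W_K)`
(tree `tamagawaProduct_variableChange_eq`) and `padicValRat_norm_mul_tamagawaProduct_eq_of_local`.
[cite: Milne1972ArithmeticAV, §1 Thm. 1 and §2 (through DokchitserDokchitserAnnals2010, §2.1, proof of Thm. 8)] -/
theorem padicValRat_norm_mul_tamagawaProduct_eq_of_local_baseChange {C' : VariableChange K}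
    (hW' : C' • W.baseChange K = W') {u' : K} (hu' : u' ≠ 0) {ud : ℚ}
    (hud : ud ≠ 0) (p : ℕ) [Fact p.Prime] (v₀ : HeightOneSpectrum (𝓞 ℚ))
    (hv₀ : (primesEquiv v₀ : ℕ) = p)
    (hT : ∀ v : HeightOneSpectrum (𝓞 ℚ), v ≠ v₀ →
      ∑ w ∈ (HeightOneSpectrum.finite_setOf_under_eq_of_numberField (K := K) v).toFinset,
          padicValNat p (((W.baseChange K).baseChange (w.adicCompletion K)).localTamagawaNumber
            (w.adicCompletionIntegers K)) =
        padicValNat p ((W.baseChange (v.adicCompletion ℚ)).localTamagawaNumber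
            (v.adicCompletionIntegers ℚ)) +
          padicValNat p ((Wd.baseChange (v.adicCompletion ℚ)).localTamagawaNumber
            (v.adicCompletionIntegers ℚ)))
    (hP : ∑ w ∈ (HeightOneSpectrum.finite_setOf_under_eq_of_numberField (K := K) v₀).toFinset,
          ((padicValNat p (((W.baseChange K).baseChange (w.adicCompletion K)).localTamagawaNumber
              (w.adicCompletionIntegers K)) : ℤ) +
            (w.asIdeal.inertiaDeg (𝓞 ℚ) : ℤ) * (-log (w.valuation K u'))) =
        (padicValNat p ((W.baseChange (v₀.adicCompletion ℚ)).localTamagawaNumber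
            (v₀.adicCompletionIntegers ℚ)) : ℤ) +
          padicValNat p ((Wd.baseChange (v₀.adicCompletion ℚ)).localTamagawaNumber
            (v₀.adicCompletionIntegers ℚ)) +
          (-log (v₀.valuation ℚ ud))) :
    padicValRat p (|Algebra.norm ℚ u'| * W'.tamagawaProduct : ℚ) =
      padicValRat p (|ud| * (W.tamagawaProduct * Wd.tamagawaProduct) : ℚ) := by
  haveI : (W.baseChange K).IsElliptic := by rw [baseChange]; infer_instance
  have hprod : W'.tamagawaProduct = (W.baseChange K).tamagawaProduct := by
    rw [← hW']; exact tamagawaProduct_variableChange_eq (W.baseChange K) C'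
  rw [hprod]
  exact padicValRat_norm_mul_tamagawaProduct_eq_of_local W Wd (W.baseChange K) hu' hud p v₀ hv₀
    hT hP

end Assembly

end Summit.BirchSwinnertonDyer.Rank1Residual.AdditivePotMult

end
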